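import Literature.NumberTheory.Rogawski1990.TestFunctionsNonempty            -- ★ B14: `exists_archBump`; brings ★ `HarishChandraDiracGL` (`exists_closedBall_subset_range_val`, `hsQ`, `exists_hsQ_lt_imp_norm_lt`)
import Literature.NumberTheory.Rogawski1990.ArchSmoothAmbientLift              -- ★ 3A: `ArchSmooth₂.hasCompactSupport`∕`.continuous`; brings ★ `ArchimedeanTransfer` (`ArchSmooth₂`, `endoEmbArch`)
import Literature.NumberTheory.Automorphic.ArchStableConjugacyLocalGlobal        -- ★ (g1): `coe_archPiEquivCM_apply`
import HarnessLib

/-!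
# Product test functions on `H_∞ = U(Φ₂)(L⁺ ⊗ ℝ) × U(Φ₁)(L⁺ ⊗ ℝ)`: an `ArchSmooth₂` function `(a, b) ↦ (∏_w f_w(a_w)) · g(b)` with prescribed positive local factors
# (Rogawski 1990 §14.3; Borel–Jacquet 1979 §4.1; Borel 1972 3.4)

Topic `NumberTheory/Rogawski1990`; namespaces `Literature.NumberTheory.Automorphic` (§1 ambient calculus on `M₃(L ⊗ ℝ)`) and `Literature.NumberTheory.Rogawski1990` (§2–§3).
THEOREMS ONLY (no `def`, no instance, no notation, no axiom, no named fact, no `sorry`).  Cell `pub/hodgecm-mathlib`, crux H413 (`stmt-HodgeConjecture-24833`), F0∕P3c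
line LH3 (closer stub `stub_N9`, DIRECT ROAD), organ J; brick **(N1) «ARCH PRODUCT TEST FUNCTIONS»** (LH3-plan (g3) RULINGS #4 (b) 2026-09-02T07:40:37Z, census LH5-p04 (g2)
07:30:56Z): the non-vanishing test functions of J's jump computation are LOAD-BEARING, and the product-over-places form is what ★ (P1) `chartOrbH_eq_prod_chartOrbHLoc` eats.

THE CONSTRUCTION.  `ArchSmooth₂` (★ `ArchimedeanTransfer`) is «restriction along `ι_∞ : H_∞ ↪ GL₃(L ⊗ ℝ)` of a continuous, compactly supported, right-exp-smooth `φ`».  We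
take `φ = Φ ∘ val` for the AMBIENT bump on `M₃(L ⊗ ℝ) = ∏_w M₃(ℂ)` (no real places, ★ `isEmpty_isReal`)
`Φ(X) = β(R X) · ∏_w β(Q_w X) · β(P_w X)`, ONE `β : ContDiffBump 0` on `ℝ`, where, for the centre `x₀ = ι_∞(a₀, b₀)`: `R` = the sum over all places and the four
OFF-pattern entries `(0,1),(1,0),(1,2),(2,1)` of `‖(X_ij)_w‖²`; `Q_w` = the sum over the four CORNER entries of `‖(X_ij)_w − (x₀,ij)_w‖²`; `P_w = ‖(X₁₁)_w − (x₀,₁₁)_w‖²`.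
* §1 smoothness of the coordinates (`contDiff_apply_snd_apply`: entries are `ℝ`-linear on a finite-dimensional space), the open units (`exists_closedBall_subset_range_val_of_isUnit`,
  `isCompact_val_preimage_closedBall'`), and `hsQ` read place by place (`hsQ_eq_sum_places`).
* §2 the pattern `ι_∞(a, b) = (a₀₀ 0 a₀₁; 0 b 0; a₁₀ 0 a₁₁)` entrywise (★ `coe_endoEmbArch`, ★ `coe_endoGL_eq`) and its place components (★ `coe_archPiEquivCM_apply`).
* §3 **`exists_archSmooth₂_prod`**: for ANY prescribed `a₀ : ∀ w, U(Φ₂)_w` and `b₀ ∈ U(Φ₁)_∞` there are REAL local factors `f_w ≥ 0` on `U(Φ₂)_w` and `g ≥ 0` on `U(Φ₁)_∞`,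
  continuous, compactly supported, with `f_w(a₀ w) = 1`, `g(b₀) = 1`, such that `k ↦ (∏_w f_w((e_A k.1) w)) · g(k.2)` (cast to `ℂ`) is `ArchSmooth₂ L`: smooth along
  `X ↦ y·exp X` because `Φ` is `C^∞` (★ `isArchSmooth_of_contDiff_slice`, ★ `contDiff_exp_matrix_mixedSpace`); compactly supported in `GL₃` because `Φ X ≠ 0` forces
  `hsQ(X − x₀) < r₀`, hence `‖X − x₀‖ < ε` (★ `exists_hsQ_lt_imp_norm_lt`) inside a compact ball of units around `x₀`; the product form because the off-pattern entries of
  `ι_∞(a,b)` vanish (`β 0 = 1`) and the pattern entries at `w` are the entries of `(e_A a) w`, `(e_B b) w`; compact support of the local factors by restriction along the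
  closed slices `x ↦ (e_A⁻¹(a₀[w ↦ x]), b₀)` and `b ↦ (e_A⁻¹ a₀, b)` of `H_∞` (★ `ArchSmooth₂.hasCompactSupport`, ★ `isClosedEmbedding` bookkeeping).
HONEST LABEL: HC_CM is proved only modulo the 7 printed citations (2 remaining: hLiu418 = `stmt-HodgeConjecture-24832`, h413 = `stmt-HodgeConjecture-24833`) until rung 0
closes; count-neutral.

## References
* [Rogawski1990] J. D. Rogawski, *Automorphic Representations of Unitary Groups in Three Variables*, Ann. of Math. Stud. 123 (1990), §14.3 p. 234 (`f^H_∞ ∈ C_c^∞(H_∞)`), §4.8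
  Case (a) p. 53 (the pattern `(* 0 *; 0 * 0; * 0 *)`).
* [BorelJacquet1979] A. Borel, H. Jacquet, *Automorphic forms and automorphic representations*, PSPM 33.1 (1979), §4.1 (`C_c^∞(G_∞)`; pure tensors over the places).
* [Borel1972] A. Borel, *Représentations de groupes localement compacts*, LNM 276 (1972), 3.4 (smooth bumps on a Lie group).
-/

open scoped MatrixGroups Matrix ContDiff Classical Topology
open NumberField NumberField.InfinitePlace NumberField.mixedEmbedding Set

noncomputable section

namespace Literature.NumberTheory.Automorphic

-- the scoped `ℓ^∞`-operator norm on `M₃(L ⊗ ℝ)` (the one through which ★ `IsArchSmooth` is defined)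
open scoped Matrix.Norms.Operator

/-! ## §1 Ambient calculus on `M₃(L ⊗ ℝ)` -/

section Ambient

variable (L : Type) [Field L] [NumberField L]

set_option backward.isDefEq.respectTransparency false in
/-- The complex coordinate `X ↦ (X i j)_w` is `C^∞` on `M₃(L ⊗ ℝ)` (an `ℝ`-linear map on a finite-dimensional space). [cite: BorelJacquet1979, §4.1] -/
theorem contDiff_apply_snd_apply (i j : Fin 3) (w : {w : InfinitePlace L // IsComplex w}) :
    ContDiff ℝ ∞ (fun X : Matrix (Fin 3) (Fin 3) (mixedSpace L) => (X i j).2 w) :=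
  haveI : FiniteDimensional ℝ (Matrix (Fin 3) (Fin 3) (mixedSpace L)) := finiteDimensional_matrix_mixedSpace
  (LinearMap.toContinuousLinearMap (⟨⟨fun X => (X i j).2 w, fun _ _ => rfl⟩, fun _ _ => rfl⟩ : Matrix (Fin 3) (Fin 3) (mixedSpace L) →ₗ[ℝ] ℂ)).contDiff

set_option backward.isDefEq.respectTransparency false in
/-- `X ↦ ‖(X i j)_w − c‖²` is `C^∞`. [cite: BorelJacquet1979, §4.1] -/
theorem contDiff_norm_sq_apply_snd_apply_sub (i j : Fin 3) (w : {w : InfinitePlace L // IsComplex w}) (c : ℂ) :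
    ContDiff ℝ ∞ (fun X : Matrix (Fin 3) (Fin 3) (mixedSpace L) => ‖(X i j).2 w - c‖ ^ 2) :=
  (contDiff_norm_sq ℝ (n := ∞)).comp ((contDiff_apply_snd_apply L i j w).sub contDiff_const)


set_option backward.isDefEq.respectTransparency false in
/-- `X ↦ ‖(X i j)_w‖²` is `C^∞`. [cite: BorelJacquet1979, §4.1] -/
theorem contDiff_norm_sq_apply_snd_apply (i j : Fin 3) (w : {w : InfinitePlace L // IsComplex w}) :
    ContDiff ℝ ∞ (fun X : Matrix (Fin 3) (Fin 3) (mixedSpace L) => ‖(X i j).2 w‖ ^ 2) :=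
  (contDiff_norm_sq ℝ (n := ∞)).comp (contDiff_apply_snd_apply L i j w)

set_option backward.isDefEq.respectTransparency false in
/-- Some closed ball around an INVERTIBLE `x₀ ∈ M₃(L ⊗ ℝ)` consists of invertible matrices (the units of a Banach algebra are open; ★ `exists_closedBall_subset_range_val` is the
case `x₀ = 1`). [cite: Borel1972, 3.4] -/
theorem exists_closedBall_subset_range_val_of_isUnit {x₀ : Matrix (Fin 3) (Fin 3) (mixedSpace L)} (hx : IsUnit x₀) :
    ∃ ε > (0 : ℝ), Metric.closedBall x₀ ε ⊆ range (Units.val : GL (Fin 3) (mixedSpace L) → Matrix (Fin 3) (Fin 3) (mixedSpace L)) := by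
  have hopen : IsOpen (range (Units.val : GL (Fin 3) (mixedSpace L) → Matrix (Fin 3) (Fin 3) (mixedSpace L))) :=
    (Units.isOpenEmbedding_val (R := Matrix (Fin 3) (Fin 3) (mixedSpace L))).isOpen_range
  obtain ⟨ε, hε, hball⟩ := Metric.mem_nhds_iff.1 (hopen.mem_nhds ⟨hx.unit, rfl⟩)
  exact ⟨ε / 2, half_pos hε, (Metric.closedBall_subset_ball (half_lt_self hε)).trans hball⟩

set_option backward.isDefEq.respectTransparency false in
/-- The preimage in `GL₃(L ⊗ ℝ)` of a closed ball of invertible matrices is compact (★ `isCompact_val_preimage_closedBall` at a general centre: `Units.val` is an open embedding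
and `M₃(L ⊗ ℝ)` is finite-dimensional). [cite: Borel1972, 3.4] -/
theorem isCompact_val_preimage_closedBall' {x₀ : Matrix (Fin 3) (Fin 3) (mixedSpace L)} {ε : ℝ}
    (hε : Metric.closedBall x₀ ε ⊆ range (Units.val : GL (Fin 3) (mixedSpace L) → Matrix (Fin 3) (Fin 3) (mixedSpace L))) :
    IsCompact ((Units.val : GL (Fin 3) (mixedSpace L) → Matrix (Fin 3) (Fin 3) (mixedSpace L)) ⁻¹' Metric.closedBall x₀ ε) := by
  haveI : FiniteDimensional ℝ (Matrix (Fin 3) (Fin 3) (mixedSpace L)) := finiteDimensional_matrix_mixedSpace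
  haveI : ProperSpace (Matrix (Fin 3) (Fin 3) (mixedSpace L)) := FiniteDimensional.proper ℝ _
  exact (Units.isOpenEmbedding_val (R := Matrix (Fin 3) (Fin 3) (mixedSpace L))).isInducing.isCompact_preimage' (isCompact_closedBall _ _) hε

variable [IsCMField L]

set_option backward.isDefEq.respectTransparency false in
/-- **`hsQ` read place by place** (no real places for a CM field, ★ `isEmpty_isReal`): `Q(z) = ∑_w ∑_{i,j} ‖(z_ij)_w‖²`. [cite: Borel1972, 3.4] -/
theorem hsQ_eq_sum_places (z : Matrix (Fin 3) (Fin 3) (mixedSpace L)) :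
    hsQ z = ∑ w : {w : InfinitePlace L // IsComplex w}, ∑ j : Fin 3, ∑ i : Fin 3, ‖(z i j).2 w‖ ^ 2 := by
  haveI : IsEmpty {w : InfinitePlace L // IsReal w} :=
    UnitaryGroup.isEmpty_isReal (↥(maximalRealSubfield L)) L (IsCMField.complexConj L) (IsCMField.complexConj_ne_one L) (UnitaryGroup.complexConj_smul_infinitePlace L)
  rw [hsQ_eq_sum]
  simp only [Finset.univ_eq_empty, Finset.sum_empty, zero_add, Complex.normSq_eq_norm_sq]
  calc ∑ j : Fin 3, ∑ i : Fin 3, ∑ w : {w : InfinitePlace L // IsComplex w}, ‖(z i j).2 w‖ ^ 2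
      = ∑ j : Fin 3, ∑ w : {w : InfinitePlace L // IsComplex w}, ∑ i : Fin 3, ‖(z i j).2 w‖ ^ 2 := Finset.sum_congr rfl fun j _ => Finset.sum_comm
    _ = ∑ w : {w : InfinitePlace L // IsComplex w}, ∑ j : Fin 3, ∑ i : Fin 3, ‖(z i j).2 w‖ ^ 2 := Finset.sum_comm

end Ambient

end Literature.NumberTheory.Automorphic

/-! ## §2 The pattern `ι_∞(a, b)` entrywise and place by place -/

namespace Literature.NumberTheory.Rogawski1990

open Literature.NumberTheory.Automorphic Literature.NumberTheory.Automorphic.UnitaryGroup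

section Pattern

variable (L : Type) [Field L] [NumberField L] [IsCMField L]

/-- **The matrix of `ι_∞(a, b)`**: `(a₀₀ 0 a₀₁; 0 b₀₀ 0; a₁₀ 0 a₁₁)` (★ `coe_endoEmbArch`, ★ `coe_endoGL_eq`). [cite: Rogawski1990, §4.8 Case (a) p. 53] -/
theorem coe_endoEmbArch_eq (k : (↥(arch (↥(maximalRealSubfield L)) L (IsCMField.complexConj L) 2 (Matrix.of fun i j : Fin 2 => if i.val + j.val + 1 = 2 then (1 : L) else 0)) × ↥(arch (↥(maximalRealSubfield L)) L (IsCMField.complexConj L) 1 (Matrix.of fun i j : Fin 1 => if i.val + j.val + 1 = 1 then (1 : L) else 0)))) :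
    ((endoEmbArch L k).val : Matrix (Fin 3) (Fin 3) (mixedSpace L)) =
      !![((k.1.val : GL (Fin 2) (mixedSpace L)) : Matrix (Fin 2) (Fin 2) (mixedSpace L)) 0 0, 0, ((k.1.val : GL (Fin 2) (mixedSpace L)) : Matrix (Fin 2) (Fin 2) (mixedSpace L)) 0 1;
        0, ((k.2.val : GL (Fin 1) (mixedSpace L)) : Matrix (Fin 1) (Fin 1) (mixedSpace L)) 0 0, 0;
        ((k.1.val : GL (Fin 2) (mixedSpace L)) : Matrix (Fin 2) (Fin 2) (mixedSpace L)) 1 0, 0, ((k.1.val : GL (Fin 2) (mixedSpace L)) : Matrix (Fin 2) (Fin 2) (mixedSpace L)) 1 1] := by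
  rw [coe_endoEmbArch, coe_endoGL_eq]

/-- The `w`-coordinate of an entry of `a ∈ U(Φ₂)_∞` is the corresponding entry of its place component `(e_A a) w ∈ U(Φ₂)_w` (★ `coe_archPiEquivCM_apply`, definitional).
[cite: BorelJacquet1979, §4.1] -/
theorem snd_coe_fst_apply (k : (↥(arch (↥(maximalRealSubfield L)) L (IsCMField.complexConj L) 2 (Matrix.of fun i j : Fin 2 => if i.val + j.val + 1 = 2 then (1 : L) else 0)) × ↥(arch (↥(maximalRealSubfield L)) L (IsCMField.complexConj L) 1 (Matrix.of fun i j : Fin 1 => if i.val + j.val + 1 = 1 then (1 : L) else 0)))) (w : {w : InfinitePlace L // IsComplex w}) (i j : Fin 2) :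
    (((k.1.val : GL (Fin 2) (mixedSpace L)) : Matrix (Fin 2) (Fin 2) (mixedSpace L)) i j).2 w =
      ((archPiEquivCM 2 L (Matrix.of fun i j : Fin 2 => if i.val + j.val + 1 = 2 then (1 : L) else 0) k.1 w : GL (Fin 2) ℂ) : Matrix (Fin 2) (Fin 2) ℂ) i j := rfl

/-- The same for the `U(Φ₁)`-factor. [cite: BorelJacquet1979, §4.1] -/
theorem snd_coe_snd_apply (k : (↥(arch (↥(maximalRealSubfield L)) L (IsCMField.complexConj L) 2 (Matrix.of fun i j : Fin 2 => if i.val + j.val + 1 = 2 then (1 : L) else 0)) × ↥(arch (↥(maximalRealSubfield L)) L (IsCMField.complexConj L) 1 (Matrix.of fun i j : Fin 1 => if i.val + j.val + 1 = 1 then (1 : L) else 0)))) (w : {w : InfinitePlace L // IsComplex w}) :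
    (((k.2.val : GL (Fin 1) (mixedSpace L)) : Matrix (Fin 1) (Fin 1) (mixedSpace L)) 0 0).2 w =
      ((archPiEquivCM 1 L (Matrix.of fun i j : Fin 1 => if i.val + j.val + 1 = 1 then (1 : L) else 0) k.2 w : GL (Fin 1) ℂ) : Matrix (Fin 1) (Fin 1) ℂ) 0 0 := rfl

end Pattern

/-! ## §3 The product test function -/

section Product

variable (L : Type) [Field L] [NumberField L] [IsCMField L]

-- the scoped `ℓ^∞`-operator norm of ★ `IsArchSmooth`
open scoped Matrix.Norms.Operator


/-- **The slice `x ↦ (e_A⁻¹(a₀[w ↦ x]), b₀)` of `H_∞` at the place `w` is a CLOSED EMBEDDING** of `U(Φ₂)_w` (continuous retraction `k ↦ (e_A k.1) w`; the range is cut out by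
the closed conditions `k.2 = b₀`, `(e_A k.1) w′ = a₀ w′`, `w′ ≠ w`). [cite: BorelJacquet1979, §4.1] -/
theorem isClosedEmbedding_sliceA (a₀ : ∀ w : {w : InfinitePlace L // IsComplex w}, ↥(archLocal L 2 (Matrix.of fun i j : Fin 2 => if i.val + j.val + 1 = 2 then (1 : L) else 0) w)) (b₀ : ↥(arch (↥(maximalRealSubfield L)) L (IsCMField.complexConj L) 1 (Matrix.of fun i j : Fin 1 => if i.val + j.val + 1 = 1 then (1 : L) else 0))) (w : {w : InfinitePlace L // IsComplex w}) :
    Topology.IsClosedEmbedding (fun x : ↥(archLocal L 2 (Matrix.of fun i j : Fin 2 => if i.val + j.val + 1 = 2 then (1 : L) else 0) w) => (((archPiEquivCM 2 L (Matrix.of fun i j : Fin 2 => if i.val + j.val + 1 = 2 then (1 : L) else 0)).symm (Function.update a₀ w x), b₀) : (↥(arch (↥(maximalRealSubfield L)) L (IsCMField.complexConj L) 2 (Matrix.of fun i j : Fin 2 => if i.val + j.val + 1 = 2 then (1 : L) else 0)) × ↥(arch (↥(maximalRealSubfield L)) L (IsCMField.complexConj L) 1 (Matrix.of fun i j : Fin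 1 => if i.val + j.val + 1 = 1 then (1 : L) else 0))))) := by
  have hu : Continuous fun x : ↥(archLocal L 2 (Matrix.of fun i j : Fin 2 => if i.val + j.val + 1 = 2 then (1 : L) else 0) w) => Function.update a₀ w x := (continuous_const (y := a₀)).update w continuous_id
  refine ⟨Topology.IsEmbedding.of_leftInverse (f := fun k : (↥(arch (↥(maximalRealSubfield L)) L (IsCMField.complexConj L) 2 (Matrix.of fun i j : Fin 2 => if i.val + j.val + 1 = 2 then (1 : L) else 0)) × ↥(arch (↥(maximalRealSubfield L)) L (IsCMField.complexConj L) 1 (Matrix.of fun i j : Fin 1 => if i.val + j.val + 1 = 1 then (1 : L) else 0))) => archPiEquivCM 2 L (Matrix.of fun i j : Fin 2 => if i.val + j.val + 1 = 2 then (1 : L) else 0) k.1 w) (fun x => ?_) ?_ ?_, ?_⟩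
  · show archPiEquivCM 2 L (Matrix.of fun i j : Fin 2 => if i.val + j.val + 1 = 2 then (1 : L) else 0) ((archPiEquivCM 2 L (Matrix.of fun i j : Fin 2 => if i.val + j.val + 1 = 2 then (1 : L) else 0)).symm (Function.update a₀ w x)) w = x
    rw [ContinuousMulEquiv.apply_symm_apply, Function.update_self]
  · exact (continuous_apply w).comp ((archPiEquivCM 2 L (Matrix.of fun i j : Fin 2 => if i.val + j.val + 1 = 2 then (1 : L) else 0)).continuous.comp continuous_fst)
  · exact ((archPiEquivCM 2 L (Matrix.of fun i j : Fin 2 => if i.val + j.val + 1 = 2 then (1 : L) else 0)).symm.continuous.comp hu).prodMk continuous_const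
  · have hrange : Set.range (fun x : ↥(archLocal L 2 (Matrix.of fun i j : Fin 2 => if i.val + j.val + 1 = 2 then (1 : L) else 0) w) => (((archPiEquivCM 2 L (Matrix.of fun i j : Fin 2 => if i.val + j.val + 1 = 2 then (1 : L) else 0)).symm (Function.update a₀ w x), b₀) : (↥(arch (↥(maximalRealSubfield L)) L (IsCMField.complexConj L) 2 (Matrix.of fun i j : Fin 2 => if i.val + j.val + 1 = 2 then (1 : L) else 0)) × ↥(arch (↥(maximalRealSubfield L)) L (IsCMField.complexConj L) 1 (Matrix.of fun i j : Fin 1 => if i.val + j.val + 1 = 1 then (1 : L) else 0))))) =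
        {k | k.2 = b₀} ∩ ⋂ (w' : {w : InfinitePlace L // IsComplex w}) (_ : w' ≠ w), {k | archPiEquivCM 2 L (Matrix.of fun i j : Fin 2 => if i.val + j.val + 1 = 2 then (1 : L) else 0) k.1 w' = a₀ w'} := by
      ext k
      simp only [Set.mem_range, Set.mem_inter_iff, Set.mem_setOf_eq, Set.mem_iInter]
      constructor
      · rintro ⟨x, rfl⟩
        refine ⟨rfl, fun w' hw' => ?_⟩
        rw [ContinuousMulEquiv.apply_symm_apply, Function.update_of_ne hw']
      · rintro ⟨h2, h1⟩
        refine ⟨archPiEquivCM 2 L (Matrix.of fun i j : Fin 2 => if i.val + j.val + 1 = 2 then (1 : L) else 0) k.1 w, Prod.ext ?_ h2.symm⟩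
        apply (archPiEquivCM 2 L (Matrix.of fun i j : Fin 2 => if i.val + j.val + 1 = 2 then (1 : L) else 0)).injective
        rw [ContinuousMulEquiv.apply_symm_apply]
        funext w'
        by_cases hw' : w' = w
        · subst hw'; rw [Function.update_self]
        · rw [Function.update_of_ne hw', h1 w' hw']
    rw [hrange]
    exact (isClosed_eq continuous_snd continuous_const).inter
      (isClosed_iInter fun w' => isClosed_iInter fun _ =>
        isClosed_eq ((continuous_apply w').comp ((archPiEquivCM 2 L (Matrix.of fun i j : Fin 2 => if i.val + j.val + 1 = 2 then (1 : L) else 0)).continuous.comp continuous_fst)) continuous_const)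

/-- The slice `b ↦ (A₀, b)` of `H_∞` is a closed embedding of `U(Φ₁)_∞`. [cite: BorelJacquet1979, §4.1] -/
theorem isClosedEmbedding_sliceB (A₀ : ↥(arch (↥(maximalRealSubfield L)) L (IsCMField.complexConj L) 2 (Matrix.of fun i j : Fin 2 => if i.val + j.val + 1 = 2 then (1 : L) else 0))) : Topology.IsClosedEmbedding (fun b : ↥(arch (↥(maximalRealSubfield L)) L (IsCMField.complexConj L) 1 (Matrix.of fun i j : Fin 1 => if i.val + j.val + 1 = 1 then (1 : L) else 0)) => ((A₀, b) : (↥(arch (↥(maximalRealSubfield L)) L (IsCMField.complexConj L) 2 (Matrix.of fun i j : Fin 2 => if i.val + j.val + 1 = 2 then (1 : L) else 0)) × ↥(arch (↥(maximalRealSubfield L)) L (IsCMField.complexConj L) 1 (Matrix.of fun i j : Fin 1 => if i.val + j.val + 1 = 1 then (1 : L) else 0))))) := by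
  refine ⟨Topology.IsEmbedding.of_leftInverse (f := fun k : (↥(arch (↥(maximalRealSubfield L)) L (IsCMField.complexConj L) 2 (Matrix.of fun i j : Fin 2 => if i.val + j.val + 1 = 2 then (1 : L) else 0)) × ↥(arch (↥(maximalRealSubfield L)) L (IsCMField.complexConj L) 1 (Matrix.of fun i j : Fin 1 => if i.val + j.val + 1 = 1 then (1 : L) else 0))) => k.2) (fun _ => rfl) continuous_snd (continuous_const.prodMk continuous_id), ?_⟩
  have hrange : Set.range (fun b : ↥(arch (↥(maximalRealSubfield L)) L (IsCMField.complexConj L) 1 (Matrix.of fun i j : Fin 1 => if i.val + j.val + 1 = 1 then (1 : L) else 0)) => ((A₀, b) : (↥(arch (↥(maximalRealSubfield L)) L (IsCMField.complexConj L) 2 (Matrix.of fun i j : Fin 2 => if i.val + j.val + 1 = 2 then (1 : L) else 0)) × ↥(arch (↥(maximalRealSubfield L)) L (IsCMField.complexConj L) 1 (Matrix.of fun i j : Fin 1 => if i.val + j.val + 1 = 1 then (1 : L) else 0))))) = {k | k.1 = A₀} := by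
    ext k
    simp only [Set.mem_range, Set.mem_setOf_eq]
    exact ⟨fun ⟨b, hb⟩ => hb ▸ rfl, fun h => ⟨k.2, Prod.ext h.symm rfl⟩⟩
  rw [hrange]
  exact isClosed_eq continuous_fst continuous_const

set_option backward.isDefEq.respectTransparency false in
/-- **A SMOOTH COMPACTLY SUPPORTED PATTERN BUMP ON `GL₃(L ⊗ ℝ)` AROUND AN INVERTIBLE `x₀`**, in the place-by-place product form
`φ(y) = β(∑_w OFF_w(y − x₀)) · ∏_w β(CORNERS_w(y − x₀)) · β(MIDDLE_w(y − x₀))` for ONE bump `β` on `ℝ` at `0` (`β ≥ 0`, `β 0 = 1`): continuous, compactly supported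
inside a compact ball of units around `x₀`, and smooth along `X ↦ y·exp X` (★ `IsArchSmooth`). [cite: Borel1972, 3.4] [cite: BorelJacquet1979, §4.1] -/
theorem exists_patternBump (x₀ : Matrix (Fin 3) (Fin 3) (mixedSpace L)) (hx₀ : IsUnit x₀) :
    ∃ (β : ContDiffBump (0 : ℝ)) (φ : GL (Fin 3) (mixedSpace L) → ℂ),
      Continuous φ ∧ HasCompactSupport φ ∧ IsArchSmooth (archGroupGL 3 L).carrier.subtype φ ∧
      ∀ y : GL (Fin 3) (mixedSpace L), φ y =
        ((β (∑ w : {w : InfinitePlace L // IsComplex w}, (‖((y : Matrix (Fin 3) (Fin 3) (mixedSpace L)) 0 1).2 w - (x₀ 0 1).2 w‖ ^ 2 + ‖((y : Matrix (Fin 3) (Fin 3) (mixedSpace L)) 1 0).2 w - (x₀ 1 0).2 w‖ ^ 2 + ‖((y : Matrix (Fin 3) (Fin 3) (mixedSpace L)) 1 2).2 w - (x₀ 1 2).2 w‖ ^ 2 + ‖((y : Matrix (Fin 3) (Fin 3) (mixedSpace L)) 2 1).2 w - (x₀ 2 1).2 w‖ ^ 2)) *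
            ∏ w : {w : InfinitePlace L // IsComplex w}, (β (‖((y : Matrix (Fin 3) (Fin 3) (mixedSpace L)) 0 0).2 w - (x₀ 0 0).2 w‖ ^ 2 + ‖((y : Matrix (Fin 3) (Fin 3) (mixedSpace L)) 0 2).2 w - (x₀ 0 2).2 w‖ ^ 2 + ‖((y : Matrix (Fin 3) (Fin 3) (mixedSpace L)) 2 0).2 w - (x₀ 2 0).2 w‖ ^ 2 + ‖((y : Matrix (Fin 3) (Fin 3) (mixedSpace L)) 2 2).2 w - (x₀ 2 2).2 w‖ ^ 2) * β (‖((y : Matrix (Fin 3) (Fin 3) (mixedSpace L)) 1 1).2 w - (x₀ 1 1).2 w‖ ^ 2)) : ℝ) : ℂ) := by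
  -- radii: a compact ball of units around `x₀`, the matching `hsQ`-radius, and the bump radius
  obtain ⟨ε, hε, hball⟩ := exists_closedBall_subset_range_val_of_isUnit L hx₀
  obtain ⟨r₀, hr₀, hr₀ε⟩ := exists_hsQ_lt_imp_norm_lt (n := 3) (K := L) hε
  obtain ⟨m, hm⟩ : ∃ m : ℕ, m = Fintype.card {w : InfinitePlace L // IsComplex w} := ⟨_, rfl⟩
  obtain ⟨ρ, hρ⟩ : ∃ ρ : ℝ, ρ = r₀ / (2 * m + 2) := ⟨_, rfl⟩
  have hρpos : 0 < ρ := by rw [hρ]; positivity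
  have hρsum : ρ + m * (ρ + ρ) < r₀ := by
    have h2 : (0 : ℝ) < 2 * m + 2 := by positivity
    have hr : r₀ = ρ * (2 * m + 2) := by rw [hρ, div_mul_cancel₀ _ h2.ne']
    rw [hr]
    nlinarith
  let β : ContDiffBump (0 : ℝ) := ⟨ρ / 2, ρ, half_pos hρpos, half_lt_self hρpos⟩
  have hβlt : ∀ t : ℝ, β t ≠ 0 → t < ρ := fun t ht => by
    have h := β.support_eq ▸ Function.mem_support.2 ht
    rw [Metric.mem_ball, Real.dist_eq, sub_zero] at h
    exact lt_of_abs_lt h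
  -- the three coordinate forms
  obtain ⟨off, hoff⟩ : ∃ off : {w : InfinitePlace L // IsComplex w} → Matrix (Fin 3) (Fin 3) (mixedSpace L) → ℝ, ∀ w X, off w X = ‖(X 0 1).2 w - (x₀ 0 1).2 w‖ ^ 2 + ‖(X 1 0).2 w - (x₀ 1 0).2 w‖ ^ 2 + ‖(X 1 2).2 w - (x₀ 1 2).2 w‖ ^ 2 + ‖(X 2 1).2 w - (x₀ 2 1).2 w‖ ^ 2 := ⟨_, fun _ _ => rfl⟩
  obtain ⟨Q, hQ⟩ : ∃ Q : {w : InfinitePlace L // IsComplex w} → Matrix (Fin 3) (Fin 3) (mixedSpace L) → ℝ, ∀ w X, Q w X = ‖(X 0 0).2 w - (x₀ 0 0).2 w‖ ^ 2 + ‖(X 0 2).2 w - (x₀ 0 2).2 w‖ ^ 2 + ‖(X 2 0).2 w - (x₀ 2 0).2 w‖ ^ 2 + ‖(X 2 2).2 w - (x₀ 2 2).2 w‖ ^ 2 := ⟨_, fun _ _ => rfl⟩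
  obtain ⟨P, hP⟩ : ∃ P : {w : InfinitePlace L // IsComplex w} → Matrix (Fin 3) (Fin 3) (mixedSpace L) → ℝ, ∀ w X, P w X = ‖(X 1 1).2 w - (x₀ 1 1).2 w‖ ^ 2 := ⟨_, fun _ _ => rfl⟩
  obtain ⟨Φ, hΦ⟩ : ∃ Φ : Matrix (Fin 3) (Fin 3) (mixedSpace L) → ℝ, ∀ X, Φ X = β (∑ w, off w X) * ∏ w, (β (Q w X) * β (P w X)) := ⟨_, fun _ => rfl⟩
  -- smoothness of `Φ`
  have hoffC : ∀ w, ContDiff ℝ ∞ (off w) := fun w => by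
    rw [show off w = fun X => ‖(X 0 1).2 w - (x₀ 0 1).2 w‖ ^ 2 + ‖(X 1 0).2 w - (x₀ 1 0).2 w‖ ^ 2 + ‖(X 1 2).2 w - (x₀ 1 2).2 w‖ ^ 2 + ‖(X 2 1).2 w - (x₀ 2 1).2 w‖ ^ 2 from funext (hoff w)]
    exact (((contDiff_norm_sq_apply_snd_apply_sub L 0 1 w _).add (contDiff_norm_sq_apply_snd_apply_sub L 1 0 w _)).add
      (contDiff_norm_sq_apply_snd_apply_sub L 1 2 w _)).add (contDiff_norm_sq_apply_snd_apply_sub L 2 1 w _)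
  have hQC : ∀ w, ContDiff ℝ ∞ (Q w) := fun w => by
    rw [show Q w = fun X => ‖(X 0 0).2 w - (x₀ 0 0).2 w‖ ^ 2 + ‖(X 0 2).2 w - (x₀ 0 2).2 w‖ ^ 2 + ‖(X 2 0).2 w - (x₀ 2 0).2 w‖ ^ 2 + ‖(X 2 2).2 w - (x₀ 2 2).2 w‖ ^ 2 from funext (hQ w)]
    exact (((contDiff_norm_sq_apply_snd_apply_sub L 0 0 w _).add (contDiff_norm_sq_apply_snd_apply_sub L 0 2 w _)).add
      (contDiff_norm_sq_apply_snd_apply_sub L 2 0 w _)).add (contDiff_norm_sq_apply_snd_apply_sub L 2 2 w _)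
  have hPC : ∀ w, ContDiff ℝ ∞ (P w) := fun w => by
    rw [show P w = fun X => ‖(X 1 1).2 w - (x₀ 1 1).2 w‖ ^ 2 from funext (hP w)]
    exact contDiff_norm_sq_apply_snd_apply_sub L 1 1 w _
  have hΦC : ContDiff ℝ ∞ Φ := by
    rw [show Φ = fun X => β (∑ w, off w X) * ∏ w, (β (Q w X) * β (P w X)) from funext hΦ]
    exact (β.contDiff.comp (ContDiff.sum fun w _ => hoffC w)).mul
      (contDiff_prod fun w _ => (β.contDiff.comp (hQC w)).mul (β.contDiff.comp (hPC w)))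
  -- support control: `Φ X ≠ 0 ⇒ ‖X - x₀‖ < ε`
  have hsQx : ∀ X : Matrix (Fin 3) (Fin 3) (mixedSpace L), hsQ (X - x₀) = ∑ w, (off w X + Q w X + P w X) := fun X => by
    rw [hsQ_eq_sum_places L]
    refine Finset.sum_congr rfl fun w _ => ?_
    simp only [Fin.sum_univ_three, Matrix.sub_apply, Prod.snd_sub, Pi.sub_apply, hoff, hQ, hP]
    ring
  have hΦε : ∀ X : Matrix (Fin 3) (Fin 3) (mixedSpace L), Φ X ≠ 0 → ‖X - x₀‖ < ε := fun X hX => by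
    rw [hΦ] at hX
    have h1 : β (∑ w, off w X) ≠ 0 := left_ne_zero_of_mul hX
    have h2 := Finset.prod_ne_zero_iff.1 (right_ne_zero_of_mul hX)
    refine hr₀ε _ ?_
    rw [hsQx]
    have hoffs : ∑ w, off w X < ρ := hβlt _ h1
    have hQP : ∑ w, (Q w X + P w X) ≤ ∑ _w : {w : InfinitePlace L // IsComplex w}, (ρ + ρ) :=
      Finset.sum_le_sum fun w _ => add_le_add (hβlt _ (left_ne_zero_of_mul (h2 w (Finset.mem_univ w)))).le
        (hβlt _ (right_ne_zero_of_mul (h2 w (Finset.mem_univ w)))).le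
    rw [Finset.sum_const, Finset.card_univ, ← hm, nsmul_eq_mul] at hQP
    calc ∑ w, (off w X + Q w X + P w X) = ∑ w, off w X + ∑ w, (Q w X + P w X) := by
          rw [← Finset.sum_add_distrib]; exact Finset.sum_congr rfl fun w _ => by ring
      _ < r₀ := by linarith
  -- the group function `φ = Φ ∘ val`
  refine ⟨β, fun y => ((Φ (y : Matrix (Fin 3) (Fin 3) (mixedSpace L)) : ℝ) : ℂ), ?_, ?_, fun y => ?_, fun y => by simp only [hΦ, hoff, hQ, hP]⟩
  · exact Complex.continuous_ofReal.comp (hΦC.continuous.comp Units.continuous_val)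
  · refine HasCompactSupport.of_support_subset_isCompact (isCompact_val_preimage_closedBall' L hball) fun y hy => ?_
    rw [Function.mem_support, Complex.ofReal_ne_zero] at hy
    rw [mem_preimage, Metric.mem_closedBall, dist_eq_norm]
    exact (hΦε _ hy).le
  · -- Mathlib idiom (Mathlib/Algebra/Lie/OfAssociative.lean): the Lie structure on `M₃(L ⊗ ℝ)` through which ★ `archGroupGL` speaks
    letI : LieRing (Matrix (Fin 3) (Fin 3) (mixedSpace L)) := LieRing.ofAssociativeRing
    letI : LieAlgebra ℝ (Matrix (Fin 3) (Fin 3) (mixedSpace L)) := LieAlgebra.ofAssociativeAlgebra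
    show ContDiff ℝ ∞ fun X : (archGroupGL 3 L).lie.toSubmodule => ((Φ (((y : GL (Fin 3) (mixedSpace L)) * expGL (X : Matrix (Fin 3) (Fin 3) (mixedSpace L)) : GL (Fin 3) (mixedSpace L)) : Matrix (Fin 3) (Fin 3) (mixedSpace L)) : ℝ) : ℂ)
    have hval : ContDiff ℝ ∞ fun X : (archGroupGL 3 L).lie.toSubmodule => (X : Matrix (Fin 3) (Fin 3) (mixedSpace L)) := (archGroupGL 3 L).lie.toSubmodule.subtypeL.contDiff
    have h : (fun X : (archGroupGL 3 L).lie.toSubmodule => ((Φ (((y : GL (Fin 3) (mixedSpace L)) * expGL (X : Matrix (Fin 3) (Fin 3) (mixedSpace L)) : GL (Fin 3) (mixedSpace L)) : Matrix (Fin 3) (Fin 3) (mixedSpace L)) : ℝ) : ℂ)) =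
        fun X : (archGroupGL 3 L).lie.toSubmodule => ((Φ (((y : GL (Fin 3) (mixedSpace L)) : Matrix (Fin 3) (Fin 3) (mixedSpace L)) * NormedSpace.exp (X : Matrix (Fin 3) (Fin 3) (mixedSpace L))) : ℝ) : ℂ) := by
      funext X; rw [Units.val_mul, coe_expGL]
    rw [h]
    exact Complex.ofRealCLM.contDiff.comp (hΦC.comp (contDiff_const.mul (contDiff_exp_matrix_mixedSpace.comp hval)))

set_option backward.isDefEq.respectTransparency false in
/-- **PRODUCT TEST FUNCTIONS ON `H_∞` WITH PRESCRIBED POSITIVE LOCAL FACTORS** ((N1) of organ J): for any `a₀ : ∀ w, U(Φ₂)_w` and `b₀ ∈ U(Φ₁)_∞` there are REAL local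
factors `f_w ≥ 0` on `U(Φ₂)_w` and `g ≥ 0` on `U(Φ₁)_∞`, continuous and compactly supported, with `f_w(a₀ w) = 1` and `g(b₀) = 1`, such that
`k ↦ (∏_w f_w((e_A k.1) w)) · g(k.2)` is an `ArchSmooth₂` test function on `H_∞` — the restriction along `ι_∞` of the pattern bump `exists_patternBump` centred at
`ι_∞(e_A⁻¹ a₀, b₀)` (file docstring). [cite: Rogawski1990, §14.3 p. 234; §4.8 Case (a) p. 53] [cite: BorelJacquet1979, §4.1] [cite: Borel1972, 3.4] -/
theorem exists_archSmooth₂_prod (a₀ : ∀ w : {w : InfinitePlace L // IsComplex w}, ↥(archLocal L 2 (Matrix.of fun i j : Fin 2 => if i.val + j.val + 1 = 2 then (1 : L) else 0) w)) (b₀ : ↥(arch (↥(maximalRealSubfield L)) L (IsCMField.complexConj L) 1 (Matrix.of fun i j : Fin 1 => if i.val + j.val + 1 = 1 then (1 : L) else 0))) :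
    ∃ (f : ∀ w : {w : InfinitePlace L // IsComplex w}, ↥(archLocal L 2 (Matrix.of fun i j : Fin 2 => if i.val + j.val + 1 = 2 then (1 : L) else 0) w) → ℝ) (g : ↥(arch (↥(maximalRealSubfield L)) L (IsCMField.complexConj L) 1 (Matrix.of fun i j : Fin 1 => if i.val + j.val + 1 = 1 then (1 : L) else 0)) → ℝ),
      (∀ w, Continuous (f w) ∧ HasCompactSupport (f w) ∧ (∀ x, 0 ≤ f w x) ∧ f w (a₀ w) = 1) ∧
      (Continuous g ∧ HasCompactSupport g ∧ (∀ b, 0 ≤ g b) ∧ g b₀ = 1) ∧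
      ArchSmooth₂ L (fun k : (↥(arch (↥(maximalRealSubfield L)) L (IsCMField.complexConj L) 2 (Matrix.of fun i j : Fin 2 => if i.val + j.val + 1 = 2 then (1 : L) else 0)) × ↥(arch (↥(maximalRealSubfield L)) L (IsCMField.complexConj L) 1 (Matrix.of fun i j : Fin 1 => if i.val + j.val + 1 = 1 then (1 : L) else 0))) => (∏ w, ((f w (archPiEquivCM 2 L (Matrix.of fun i j : Fin 2 => if i.val + j.val + 1 = 2 then (1 : L) else 0) k.1 w) : ℝ) : ℂ)) * ((g k.2 : ℝ) : ℂ)) := by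
  -- the centre `x₀ = ι_∞(A₀, b₀)`, `e_A A₀ = a₀`
  obtain ⟨A₀, hA₀⟩ : ∃ A₀ : ↥(arch (↥(maximalRealSubfield L)) L (IsCMField.complexConj L) 2 (Matrix.of fun i j : Fin 2 => if i.val + j.val + 1 = 2 then (1 : L) else 0)), archPiEquivCM 2 L (Matrix.of fun i j : Fin 2 => if i.val + j.val + 1 = 2 then (1 : L) else 0) A₀ = a₀ := ⟨_, (archPiEquivCM 2 L (Matrix.of fun i j : Fin 2 => if i.val + j.val + 1 = 2 then (1 : L) else 0)).apply_symm_apply a₀⟩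
  obtain ⟨x₀, hx₀⟩ : ∃ x₀ : Matrix (Fin 3) (Fin 3) (mixedSpace L), x₀ = ((endoEmbArch L (A₀, b₀)).val : Matrix (Fin 3) (Fin 3) (mixedSpace L)) := ⟨_, rfl⟩
  have hx₀u : IsUnit x₀ := by rw [hx₀]; exact Units.isUnit _
  obtain ⟨β, φ, hφc, hφs, hφsm, hφ⟩ := exists_patternBump L x₀ hx₀u
  have hβ0 : β 0 = 1 := β.one_of_mem_closedBall (Metric.mem_closedBall_self β.rIn_pos.le)
  -- the local factors
  obtain ⟨f, hf⟩ : ∃ f : ∀ w : {w : InfinitePlace L // IsComplex w}, ↥(archLocal L 2 (Matrix.of fun i j : Fin 2 => if i.val + j.val + 1 = 2 then (1 : L) else 0) w) → ℝ, ∀ w x, f w x =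
      β (‖((x : GL (Fin 2) ℂ) : Matrix (Fin 2) (Fin 2) ℂ) 0 0 - ((a₀ w : GL (Fin 2) ℂ) : Matrix (Fin 2) (Fin 2) ℂ) 0 0‖ ^ 2 +
         ‖((x : GL (Fin 2) ℂ) : Matrix (Fin 2) (Fin 2) ℂ) 0 1 - ((a₀ w : GL (Fin 2) ℂ) : Matrix (Fin 2) (Fin 2) ℂ) 0 1‖ ^ 2 +
         ‖((x : GL (Fin 2) ℂ) : Matrix (Fin 2) (Fin 2) ℂ) 1 0 - ((a₀ w : GL (Fin 2) ℂ) : Matrix (Fin 2) (Fin 2) ℂ) 1 0‖ ^ 2 +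
         ‖((x : GL (Fin 2) ℂ) : Matrix (Fin 2) (Fin 2) ℂ) 1 1 - ((a₀ w : GL (Fin 2) ℂ) : Matrix (Fin 2) (Fin 2) ℂ) 1 1‖ ^ 2) := ⟨_, fun _ _ => rfl⟩
  obtain ⟨g, hg⟩ : ∃ g : ↥(arch (↥(maximalRealSubfield L)) L (IsCMField.complexConj L) 1 (Matrix.of fun i j : Fin 1 => if i.val + j.val + 1 = 1 then (1 : L) else 0)) → ℝ, ∀ b, g b = ∏ w : {w : InfinitePlace L // IsComplex w},
      β (‖((archPiEquivCM 1 L (Matrix.of fun i j : Fin 1 => if i.val + j.val + 1 = 1 then (1 : L) else 0) b w : GL (Fin 1) ℂ) : Matrix (Fin 1) (Fin 1) ℂ) 0 0 -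
          ((archPiEquivCM 1 L (Matrix.of fun i j : Fin 1 => if i.val + j.val + 1 = 1 then (1 : L) else 0) b₀ w : GL (Fin 1) ℂ) : Matrix (Fin 1) (Fin 1) ℂ) 0 0‖ ^ 2) := ⟨_, fun _ => rfl⟩
  -- THE FACTORISATION on `ι_∞(H_∞)`
  have hx₀pat : ∀ w, (x₀ 0 0).2 w = ((a₀ w : GL (Fin 2) ℂ) : Matrix (Fin 2) (Fin 2) ℂ) 0 0 ∧ (x₀ 0 2).2 w = ((a₀ w : GL (Fin 2) ℂ) : Matrix (Fin 2) (Fin 2) ℂ) 0 1 ∧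
      (x₀ 2 0).2 w = ((a₀ w : GL (Fin 2) ℂ) : Matrix (Fin 2) (Fin 2) ℂ) 1 0 ∧ (x₀ 2 2).2 w = ((a₀ w : GL (Fin 2) ℂ) : Matrix (Fin 2) (Fin 2) ℂ) 1 1 ∧
      (x₀ 1 1).2 w = ((archPiEquivCM 1 L (Matrix.of fun i j : Fin 1 => if i.val + j.val + 1 = 1 then (1 : L) else 0) b₀ w : GL (Fin 1) ℂ) : Matrix (Fin 1) (Fin 1) ℂ) 0 0 ∧
      (x₀ 0 1).2 w = 0 ∧ (x₀ 1 0).2 w = 0 ∧ (x₀ 1 2).2 w = 0 ∧ (x₀ 2 1).2 w = 0 := fun w => by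
    rw [← hA₀, hx₀, coe_endoEmbArch_eq]
    exact ⟨rfl, rfl, rfl, rfl, rfl, rfl, rfl, rfl, rfl⟩
  have hfac : ∀ k : (↥(arch (↥(maximalRealSubfield L)) L (IsCMField.complexConj L) 2 (Matrix.of fun i j : Fin 2 => if i.val + j.val + 1 = 2 then (1 : L) else 0)) × ↥(arch (↥(maximalRealSubfield L)) L (IsCMField.complexConj L) 1 (Matrix.of fun i j : Fin 1 => if i.val + j.val + 1 = 1 then (1 : L) else 0))), φ (endoEmbArch L k).val = (∏ w, ((f w (archPiEquivCM 2 L (Matrix.of fun i j : Fin 2 => if i.val + j.val + 1 = 2 then (1 : L) else 0) k.1 w) : ℝ) : ℂ)) * ((g k.2 : ℝ) : ℂ) := fun k => by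
    obtain ⟨y, hy⟩ : ∃ y : Matrix (Fin 3) (Fin 3) (mixedSpace L), y = ((endoEmbArch L k).val : Matrix (Fin 3) (Fin 3) (mixedSpace L)) := ⟨_, rfl⟩
    have hypat : (y 0 0) = ((k.1.val : GL (Fin 2) (mixedSpace L)) : Matrix (Fin 2) (Fin 2) (mixedSpace L)) 0 0 ∧ (y 0 2) = ((k.1.val : GL (Fin 2) (mixedSpace L)) : Matrix (Fin 2) (Fin 2) (mixedSpace L)) 0 1 ∧
        (y 2 0) = ((k.1.val : GL (Fin 2) (mixedSpace L)) : Matrix (Fin 2) (Fin 2) (mixedSpace L)) 1 0 ∧ (y 2 2) = ((k.1.val : GL (Fin 2) (mixedSpace L)) : Matrix (Fin 2) (Fin 2) (mixedSpace L)) 1 1 ∧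
        (y 1 1) = ((k.2.val : GL (Fin 1) (mixedSpace L)) : Matrix (Fin 1) (Fin 1) (mixedSpace L)) 0 0 ∧
        y 0 1 = 0 ∧ y 1 0 = 0 ∧ y 1 2 = 0 ∧ y 2 1 = 0 := by
      rw [hy, coe_endoEmbArch_eq]
      exact ⟨rfl, rfl, rfl, rfl, rfl, rfl, rfl, rfl, rfl⟩
    obtain ⟨hy00, hy02, hy20, hy22, hy11, hy01, hy10, hy12, hy21⟩ := hypat
    have hoff0 : ∀ w, ‖(y 0 1).2 w - (x₀ 0 1).2 w‖ ^ 2 + ‖(y 1 0).2 w - (x₀ 1 0).2 w‖ ^ 2 + ‖(y 1 2).2 w - (x₀ 1 2).2 w‖ ^ 2 + ‖(y 2 1).2 w - (x₀ 2 1).2 w‖ ^ 2 = 0 := fun w => by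
      obtain ⟨-, -, -, -, -, h01, h10, h12, h21⟩ := hx₀pat w
      rw [hy01, hy10, hy12, hy21, h01, h10, h12, h21]
      simp
    have hQf : ∀ w, β (‖(y 0 0).2 w - (x₀ 0 0).2 w‖ ^ 2 + ‖(y 0 2).2 w - (x₀ 0 2).2 w‖ ^ 2 + ‖(y 2 0).2 w - (x₀ 2 0).2 w‖ ^ 2 + ‖(y 2 2).2 w - (x₀ 2 2).2 w‖ ^ 2) = f w (archPiEquivCM 2 L (Matrix.of fun i j : Fin 2 => if i.val + j.val + 1 = 2 then (1 : L) else 0) k.1 w) := fun w => by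
      obtain ⟨h00, h02, h20, h22, -, -, -, -, -⟩ := hx₀pat w
      rw [hf, hy00, hy02, hy20, hy22, h00, h02, h20, h22, snd_coe_fst_apply L k w 0 0, snd_coe_fst_apply L k w 0 1, snd_coe_fst_apply L k w 1 0,
        snd_coe_fst_apply L k w 1 1]
    have hPg : ∀ w, β (‖(y 1 1).2 w - (x₀ 1 1).2 w‖ ^ 2) =
        β (‖((archPiEquivCM 1 L (Matrix.of fun i j : Fin 1 => if i.val + j.val + 1 = 1 then (1 : L) else 0) k.2 w : GL (Fin 1) ℂ) : Matrix (Fin 1) (Fin 1) ℂ) 0 0 -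
          ((archPiEquivCM 1 L (Matrix.of fun i j : Fin 1 => if i.val + j.val + 1 = 1 then (1 : L) else 0) b₀ w : GL (Fin 1) ℂ) : Matrix (Fin 1) (Fin 1) ℂ) 0 0‖ ^ 2) := fun w => by
      obtain ⟨-, -, -, -, h11, -, -, -, -⟩ := hx₀pat w
      rw [hy11, h11, snd_coe_snd_apply L k w]
    rw [hφ, ← hy, Finset.sum_eq_zero fun w _ => hoff0 w, hβ0, one_mul, Finset.prod_mul_distrib, Complex.ofReal_mul, Complex.ofReal_prod, hg]
    congr 1
    · exact Finset.prod_congr rfl fun w _ => by rw [hQf w]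
    · rw [Finset.prod_congr rfl fun w _ => hPg w]
  -- the H_∞ function and its `ArchSmooth₂` witness
  have harch : ArchSmooth₂ L (fun k : (↥(arch (↥(maximalRealSubfield L)) L (IsCMField.complexConj L) 2 (Matrix.of fun i j : Fin 2 => if i.val + j.val + 1 = 2 then (1 : L) else 0)) × ↥(arch (↥(maximalRealSubfield L)) L (IsCMField.complexConj L) 1 (Matrix.of fun i j : Fin 1 => if i.val + j.val + 1 = 1 then (1 : L) else 0))) => (∏ w, ((f w (archPiEquivCM 2 L (Matrix.of fun i j : Fin 2 => if i.val + j.val + 1 = 2 then (1 : L) else 0) k.1 w) : ℝ) : ℂ)) * ((g k.2 : ℝ) : ℂ)) :=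
    ⟨φ, hφc, hφs, hφsm, fun k => (hfac k).symm⟩
  -- values of the local factors
  have hf0 : ∀ w x, 0 ≤ f w x := fun w x => by rw [hf]; exact β.nonneg
  have hf1 : ∀ w, f w (a₀ w) = 1 := fun w => by rw [hf]; simp only [sub_self, norm_zero]; norm_num; exact hβ0
  have hg0 : ∀ b, 0 ≤ g b := fun b => by rw [hg]; exact Finset.prod_nonneg fun w _ => β.nonneg
  have hg1 : g b₀ = 1 := by rw [hg]; refine Finset.prod_eq_one fun w _ => ?_; simp only [sub_self, norm_zero]; norm_num; exact hβ0
  -- the slices: the local factors are restrictions of the product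
  have hcs := harch.hasCompactSupport
  have hcont := harch.continuous
  have hslice : ∀ w (x : ↥(archLocal L 2 (Matrix.of fun i j : Fin 2 => if i.val + j.val + 1 = 2 then (1 : L) else 0) w)),
      (∏ w', ((f w' (archPiEquivCM 2 L (Matrix.of fun i j : Fin 2 => if i.val + j.val + 1 = 2 then (1 : L) else 0) ((archPiEquivCM 2 L (Matrix.of fun i j : Fin 2 => if i.val + j.val + 1 = 2 then (1 : L) else 0)).symm (Function.update a₀ w x)) w') : ℝ) : ℂ)) * ((g b₀ : ℝ) : ℂ) =
        ((f w x : ℝ) : ℂ) := fun w x => by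
    rw [ContinuousMulEquiv.apply_symm_apply, hg1, Complex.ofReal_one, mul_one,
      Finset.prod_eq_single_of_mem w (Finset.mem_univ w) fun w' _ hw' => by rw [Function.update_of_ne hw', hf1, Complex.ofReal_one]]
    rw [Function.update_self]
  have hsliceB : ∀ b : ↥(arch (↥(maximalRealSubfield L)) L (IsCMField.complexConj L) 1 (Matrix.of fun i j : Fin 1 => if i.val + j.val + 1 = 1 then (1 : L) else 0)), (∏ w', ((f w' (archPiEquivCM 2 L (Matrix.of fun i j : Fin 2 => if i.val + j.val + 1 = 2 then (1 : L) else 0) A₀ w') : ℝ) : ℂ)) * ((g b : ℝ) : ℂ) = ((g b : ℝ) : ℂ) := fun b => by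
    rw [hA₀, Finset.prod_eq_one fun w' _ => by rw [hf1, Complex.ofReal_one], one_mul]
  refine ⟨f, g, fun w => ⟨?_, ?_, hf0 w, hf1 w⟩, ⟨?_, ?_, hg0, hg1⟩, harch⟩
  · -- continuity of `f w` through the slice
    have h := Complex.continuous_re.comp (hcont.comp (isClosedEmbedding_sliceA L a₀ b₀ w).continuous)
    refine h.congr fun x => ?_
    show (((∏ w', ((f w' (archPiEquivCM 2 L (Matrix.of fun i j : Fin 2 => if i.val + j.val + 1 = 2 then (1 : L) else 0) ((archPiEquivCM 2 L (Matrix.of fun i j : Fin 2 => if i.val + j.val + 1 = 2 then (1 : L) else 0)).symm (Function.update a₀ w x)) w') : ℝ) : ℂ)) * ((g b₀ : ℝ) : ℂ))).re = f w x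
    rw [hslice, Complex.ofReal_re]
  · -- compact support of `f w` through the CLOSED slice
    have h := (hcs.comp_isClosedEmbedding (isClosedEmbedding_sliceA L a₀ b₀ w)).comp_left Complex.zero_re
    refine (congrArg HasCompactSupport ?_).mp h
    funext x
    show (((∏ w', ((f w' (archPiEquivCM 2 L (Matrix.of fun i j : Fin 2 => if i.val + j.val + 1 = 2 then (1 : L) else 0) ((archPiEquivCM 2 L (Matrix.of fun i j : Fin 2 => if i.val + j.val + 1 = 2 then (1 : L) else 0)).symm (Function.update a₀ w x)) w') : ℝ) : ℂ)) * ((g b₀ : ℝ) : ℂ))).re = f w x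
    rw [hslice, Complex.ofReal_re]
  · have h := Complex.continuous_re.comp (hcont.comp (isClosedEmbedding_sliceB L A₀).continuous)
    refine h.congr fun b => ?_
    show (((∏ w', ((f w' (archPiEquivCM 2 L (Matrix.of fun i j : Fin 2 => if i.val + j.val + 1 = 2 then (1 : L) else 0) A₀ w') : ℝ) : ℂ)) * ((g b : ℝ) : ℂ))).re = g b
    rw [hsliceB, Complex.ofReal_re]
  · have h := (hcs.comp_isClosedEmbedding (isClosedEmbedding_sliceB L A₀)).comp_left Complex.zero_re
    refine (congrArg HasCompactSupport ?_).mp h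
    funext b
    show (((∏ w', ((f w' (archPiEquivCM 2 L (Matrix.of fun i j : Fin 2 => if i.val + j.val + 1 = 2 then (1 : L) else 0) A₀ w') : ℝ) : ℂ)) * ((g b : ℝ) : ℂ))).re = g b
    rw [hsliceB, Complex.ofReal_re]

end Product

end Literature.NumberTheory.Rogawski1990

end
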